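import Literature.Barriers.RiemannHypothesis.DavenportHeilbronnDegreeTwo
import Literature.NumberTheory.LFunctions.BohrAlmostPeriodicProofs
import Literature.Analysis.Complex.Hurwitz
import Mathlib.NumberTheory.ModularForms.Bounds
import Mathlib.NumberTheory.ModularForms.CuspFormSubmodule
import Mathlib.Analysis.Fourier.AddCircle
import Mathlib.NumberTheory.LSeries.SumCoeff
import Mathlib.NumberTheory.LSeries.MellinEqDirichlet
import Mathlib.NumberTheory.LSeries.Deriv
import HarnessLib

/-!
# Conrey–Ghosh 1994, Theorem 2 (`ξ_48` has infinitely many zeros in `σ > 25/2`): the provable skeleton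

Companion (proofs only, D-0014/D-0026: no new named facts) of `DavenportHeilbronnDegreeTwo.lean`,
towards the named fact `Literature.Barriers.RiemannHypothesis.ConreyGhosh1994_thm2`:
`{s | 25/2 < Re s ∧ LSeriesSummable f s ∧ L(s, Δ²) = 0}` is infinite, `f(n)` the `q`-expansion
coefficients of `Δ²` (`deltaSqCoeff`).

## The printed proof (Conrey–Ghosh, Trans. AMS 342 (1994), §8–9, pp. 415–418) and what is here

Printed: "`F(s) = C(A(s) − B(s))`" with `A`, `B` the `L`-series of the two Hecke eigenforms
spanning `S_24(SL(2, ℤ))`; "It is a consequence of Deligne's Theorem that `|α(n)| ≤ d(n)`"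
(absolute convergence for `σ > 25/2`); "the idea is to construct for every `δ > 0` an auxiliary
Dirichlet series `Z_δ` with (1) a zero in `1 < σ < 1 + δ`, (2) … `|Z(s) − G(s + iT)| < ε` …
[Kronecker's theorem]. Assuming we can construct such `Z_δ` it then follows from Rouché's
Theorem that `G(s)` has infinitely many zeros in `σ > 1`"; (1) rests on the Lemma of §9
(Rankin–Selberg, Hölder, and Shahidi's theorem that `∑ α(n)²β(n)² n^{-s}` has a simple pole at
`s = 1`). Mathlib has no Hecke operators, no Euler products for eigenforms, no Deligne bound and
no Rankin–Selberg theory, so the eigenform decomposition and the Lemma are out of reach; what is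
PROVED here is everything else, in a form that reduces the fact to ONE zero:

* `abscissaOfAbsConv_coeff_le` — **absolute convergence for `Re s > (k+1)/2`** for every
  level-one cusp form of weight `k ≥ 0` (replacing "Deligne's Theorem" by the classical
  Rankin–Hecke mean square `∑_{n ≤ N} ‖a(n)‖² ≤ K N^k`, `exists_sum_norm_sq_coeff_le`, from
  Parseval on the line `Im z = 1/N` (Mathlib `hasSum_sq_fourierCoeffOn`) and the bound
  `‖f(z)‖ ≤ C (Im z)^{-k/2}` (Mathlib `CuspFormClass.exists_bound`), then `2xy ≤ x² + y²`);
  for `Δ²`: `abscissaOfAbsConv_deltaSqCoeff_le` (`≤ 25/2`).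
* `LSeries_setOf_zero_infinite` — **the Davenport–Heilbronn/Rouché step** for a general
  `L`-series: one zero `s₀` with `abscissaOfAbsConv < Re s₀` gives infinitely many zeros with
  `Re s > σ₁` (any `σ₁ < Re s₀`) at points of absolute convergence. The auxiliary series is `L`
  itself: Bohr's almost periodicity (`Literature.NumberTheory.LFunctions.bohr_almost_periodic_holds`)
  supplies vertical translates `L(s + it_k)`, `t_k → ∞`, converging to `L` uniformly on a closed
  disc about `s₀` whose boundary circle is free of zeros (isolated zeros; if `L` vanishes
  identically near `s₀` there is nothing to do), and the existence half of Hurwitz's theorem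
  (`Complex.eventually_exists_zero_mem_ball_of_tendstoUniformlyOn`, maximum modulus — in place of
  Rouché) puts a zero of each late translate in the disc; these zeros have unbounded ordinates.
* `cuspFormLambda_eq_Gamma_mul_LSeries` — `Λ_f(s) = ∫_0^∞ f(iy)y^{s−1}dy = Γ(s)(2π)^{-s}L(s,f)`
  in the half-plane of absolute convergence (Mathlib `hasSum_mellin`), linking the zeros of
  Booker–Thorne's `Λ_f` (`cuspFormLambda`) to those of the Dirichlet series.
* Assembly: `ConreyGhosh1994_thm2_of_exists_zero` (one zero of `L(s, Δ²)` with `Re s > 25/2`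
  suffices) and `ConreyGhosh1994_thm2_of_BookerThorne2014` (the fact follows from the catalogued
  fact `BookerThorne2014_thm1_levelOne`, Booker–Thorne 2014 Thm. 1 at level one, applied to
  `Δ² ∈ S_24(SL(2, ℤ))` (`exists_cuspForm_coe_eq_discriminant_sq`), which is not an eigenfunction of `T₂` —
  `not_isLevelOneHeckeEigenAt_deltaSq` of the statement file); likewise from
  `BookerThorne2014_levelOne_zeros`.

What remains for an unconditional `ConreyGhosh1994_thm2_holds` is exactly
`∃ s₀, 25/2 < Re s₀ ∧ L(s₀, Δ²) = 0`, i.e. step (1) of the printed proof (Hecke eigenbasis of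
`S_24`, Euler products, and the sign change of the twisted real series).

## References

* [ConreyGhosh1994] J. B. Conrey, A. Ghosh, Trans. Amer. Math. Soc. 342 (1994), 407–419, §8–9
  (read: PDF pp. 8–12 of the held copy `paper:doi-10-2307-2154701`).
* [BookerThorne2014] A. R. Booker, F. Thorne, Algebra Number Theory 8 (2014), 2027–2042, Thm. 1.
* [BohrMA1922] H. Bohr, Math. Ann. 85 (1922), 115–122, Satz 1 (almost periodicity; proved in
  `Literature/NumberTheory/LFunctions/BohrAlmostPeriodicProofs.lean`).
-/

noncomputable section

open Complex Filter Metric Set Topology LSeries MeasureTheory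
open UpperHalfPlane hiding I
open scoped MatrixGroups Real

namespace Literature.Barriers.RiemannHypothesis

/-! ## Rankin–Hecke mean square and absolute convergence for `Re s > (k+1)/2` -/

variable {k : ℤ}

/-- The restriction `u ↦ f(u + it)` of a level-one form to the horizontal line `Im z = t`
(`t > 0`) is continuous. [folklore] -/
theorem continuous_horizontalSlice (f : CuspForm 𝒮ℒ k) {t : ℝ} (ht : 0 < t) :
    Continuous (fun u : ℝ ↦ f ⟨u + t * I, by simpa using ht⟩) := by
  have hf : Continuous (f : ℍ → ℂ) := (CuspFormClass.holo f).continuous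
  exact hf.comp (by fun_prop)

/-- The Fourier coefficients of the slice: `∫_0^1 e^{-2πinu} f(u + it) du = e^{-2πnt} a(n)`
(the `q`-expansion coefficient formula on the line `Im z = t`). [folklore] -/
theorem fourierCoeffOn_horizontalSlice (f : CuspForm 𝒮ℒ k) {t : ℝ} (ht : 0 < t) (n : ℕ) :
    fourierCoeffOn zero_lt_one (fun u : ℝ ↦ f ⟨u + t * I, by simpa using ht⟩) n =
      Real.exp (-2 * π * n * t) * (qExpansion 1 f).coeff n := by
  rw [ModularFormClass.qExpansion_coeff_eq_intervalIntegral f one_pos one_mem_strictPeriods_SL n ht,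
    fourierCoeffOn_eq_integral]
  simp only [sub_zero, div_one, one_smul, ofReal_one, one_mul, smul_eq_mul]
  rw [← intervalIntegral.integral_const_mul]
  refine intervalIntegral.integral_congr fun u _ ↦ ?_
  rw [fourier_coe_apply, Function.Periodic.qParam]
  have h1 : (1 : ℂ) / cexp (2 * π * I * (u + t * I) / (1 : ℝ)) ^ n =
      (Real.exp (-2 * π * n * t) : ℂ)⁻¹ * cexp (2 * π * I * (-(n : ℤ) : ℤ) * u / (1 : ℝ)) := by
    push_cast
    rw [div_one, div_one, one_div, ← Complex.exp_nat_mul, ← Complex.exp_neg, ← Complex.exp_neg,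
      ← Complex.exp_add]
    congr 1
    ring_nf
    rw [I_sq]
    ring
  rw [h1]
  have h2 : (Real.exp (-2 * π * n * t) : ℂ) ≠ 0 := ofReal_ne_zero.2 (Real.exp_pos _).ne'
  field_simp
  push_cast
  ring_nf

/-- **Parseval on the line `Im z = t`.** If `‖f(z)‖ ≤ C (Im z)^{-k/2}` on `ℍ`, then for every
finite set of indices `∑ e^{-4πnt} ‖a(n)‖² ≤ (C t^{-k/2})²` (`t > 0`): Bessel's inequality for the
Fourier coefficients `e^{-2πnt}a(n)` of `u ↦ f(u + it)` on `[0, 1]`. [folklore] -/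
theorem sum_exp_mul_norm_sq_coeff_le (f : CuspForm 𝒮ℒ k) {C : ℝ}
    (hC : ∀ τ : ℍ, ‖f τ‖ ≤ C / τ.im ^ ((k : ℝ) / 2)) {t : ℝ} (ht : 0 < t) (s : Finset ℕ) :
    ∑ n ∈ s, Real.exp (-4 * π * n * t) * ‖(qExpansion 1 f).coeff n‖ ^ 2 ≤
      (C / t ^ ((k : ℝ) / 2)) ^ 2 := by
  set g : ℝ → ℂ := fun u ↦ f ⟨u + t * I, by simpa using ht⟩ with hg_def
  have hg : Continuous g := continuous_horizontalSlice f ht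
  have hbound : ∀ u, ‖g u‖ ≤ C / t ^ ((k : ℝ) / 2) := by
    intro u
    have h := hC ⟨u + t * I, by simpa using ht⟩
    have him : UpperHalfPlane.im ⟨u + t * I, by simpa using ht⟩ = t := by
      simp [UpperHalfPlane.im]
    rwa [him] at h
  have hL2 : MemLp g 2 (volume.restrict (Ioc (0 : ℝ) 1)) :=
    MemLp.of_bound hg.aestronglyMeasurable (C / t ^ ((k : ℝ) / 2)) (Eventually.of_forall hbound)
  have hP := hasSum_sq_fourierCoeffOn zero_lt_one hL2
  have hint : ∫ x in (0 : ℝ)..1, ‖g x‖ ^ 2 ≤ (C / t ^ ((k : ℝ) / 2)) ^ 2 := by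
    have h := intervalIntegral.norm_integral_le_of_norm_le_const (a := (0 : ℝ)) (b := 1)
      (f := fun x ↦ ‖g x‖ ^ 2) (C := (C / t ^ ((k : ℝ) / 2)) ^ 2) (fun x _ ↦ ?_)
    · rw [sub_zero, abs_one, mul_one] at h
      exact (Real.le_norm_self _).trans h
    · rw [Real.norm_of_nonneg (sq_nonneg _)]
      exact pow_le_pow_left₀ (norm_nonneg _) (hbound x) 2
  have hle : ∑ i ∈ s.map Nat.castEmbedding, ‖fourierCoeffOn zero_lt_one g i‖ ^ 2 ≤
      (1 - 0 : ℝ)⁻¹ • ∫ x in (0 : ℝ)..1, ‖g x‖ ^ 2 :=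
    sum_le_hasSum _ (fun i _ ↦ sq_nonneg _) hP
  rw [Finset.sum_map] at hle
  simp only [Nat.castEmbedding_apply, sub_zero, inv_one, one_smul] at hle
  refine le_trans (le_of_eq (Finset.sum_congr rfl fun n _ ↦ ?_)) (hle.trans hint)
  rw [hg_def, fourierCoeffOn_horizontalSlice f ht n, norm_mul, mul_pow, Complex.norm_real,
    Real.norm_of_nonneg (Real.exp_pos _).le, ← Real.exp_nat_mul]
  congr 2
  push_cast
  ring

/-- **Rankin–Hecke mean square bound**: for a level-one cusp form of weight `k`,
`∑_{n ≤ N} ‖a(n)‖² ≤ K N^k` (`N ≥ 1`), from Parseval at height `t = 1/N` and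
`‖f(z)‖ ≤ C (Im z)^{-k/2}` (Mathlib `CuspFormClass.exists_bound`). [folklore] -/
theorem exists_sum_norm_sq_coeff_le (f : CuspForm 𝒮ℒ k) : ∃ K : ℝ, ∀ N : ℕ, 1 ≤ N →
    ∑ n ∈ Finset.Icc 1 N, ‖(qExpansion 1 f).coeff n‖ ^ 2 ≤ K * (N : ℝ) ^ (k : ℝ) := by
  obtain ⟨C, hC⟩ := CuspFormClass.exists_bound f
  refine ⟨Real.exp (4 * π) * C ^ 2, fun N hN ↦ ?_⟩
  have hN0 : (0 : ℝ) < N := by exact_mod_cast hN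
  have ht : (0 : ℝ) < (N : ℝ)⁻¹ := inv_pos.2 hN0
  have h := sum_exp_mul_norm_sq_coeff_le f hC ht (Finset.Icc 1 N)
  -- evaluate the right-hand side at `t = 1/N`
  have hrhs : (C / ((N : ℝ)⁻¹) ^ ((k : ℝ) / 2)) ^ 2 = C ^ 2 * (N : ℝ) ^ (k : ℝ) := by
    rw [Real.inv_rpow hN0.le, div_inv_eq_mul, mul_pow]
    congr 1
    rw [← Real.rpow_natCast, ← Real.rpow_mul hN0.le]
    norm_num
  rw [hrhs] at h
  -- each weight `e^{-4πn/N}` is at least `e^{-4π}`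
  have hw : ∀ n ∈ Finset.Icc 1 N, Real.exp (-4 * π) * ‖(qExpansion 1 f).coeff n‖ ^ 2 ≤
      Real.exp (-4 * π * n * (N : ℝ)⁻¹) * ‖(qExpansion 1 f).coeff n‖ ^ 2 := by
    intro n hn
    refine mul_le_mul_of_nonneg_right (Real.exp_le_exp.2 ?_) (sq_nonneg _)
    have hnN : (n : ℝ) ≤ N := by exact_mod_cast (Finset.mem_Icc.1 hn).2
    have h1 : (n : ℝ) * (N : ℝ)⁻¹ ≤ 1 := by
      rw [← div_eq_mul_inv, div_le_one hN0]
      exact hnN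
    nlinarith [Real.pi_pos]
  have hsum := Finset.sum_le_sum hw
  rw [← Finset.mul_sum] at hsum
  have hexp : Real.exp (4 * π) * Real.exp (-4 * π) = 1 := by
    rw [← Real.exp_add]; norm_num
  calc ∑ n ∈ Finset.Icc 1 N, ‖(qExpansion 1 f).coeff n‖ ^ 2
      = Real.exp (4 * π) * (Real.exp (-4 * π) *
          ∑ n ∈ Finset.Icc 1 N, ‖(qExpansion 1 f).coeff n‖ ^ 2) := by
        rw [← mul_assoc, hexp, one_mul]
    _ ≤ Real.exp (4 * π) * (C ^ 2 * (N : ℝ) ^ (k : ℝ)) :=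
        mul_le_mul_of_nonneg_left (hsum.trans h) (Real.exp_pos _).le
    _ = Real.exp (4 * π) * C ^ 2 * (N : ℝ) ^ (k : ℝ) := by ring

/-- `2xy ≤ x² + y²` in the form used for the Dirichlet coefficients. [folklore] -/
theorem mul_le_half_add_sq (x y : ℝ) : x * y ≤ (x ^ 2 + y ^ 2) / 2 := by
  nlinarith [sq_nonneg (x - y)]

/-- **Absolute convergence for `Re s > (k+1)/2`** (classically from Rankin's mean square; in
print "a consequence of Deligne's Theorem"): the abscissa of absolute convergence of
`∑ a(n) n^{-s}`, `a(n)` the `q`-expansion coefficients of a level-one cusp form of weight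
`k ≥ 0`, is at most `(k+1)/2`. [cite: ConreyGhosh1994, §8, p. 415] -/
theorem abscissaOfAbsConv_coeff_le (f : CuspForm 𝒮ℒ k) (hk : 0 ≤ k) :
    abscissaOfAbsConv (fun n ↦ (qExpansion 1 f).coeff n) ≤ (((k : ℝ) + 1) / 2 : ℝ) := by
  set a : ℕ → ℂ := fun n ↦ (qExpansion 1 f).coeff n with ha
  obtain ⟨K, hK⟩ := exists_sum_norm_sq_coeff_le f
  -- the mean square as a big-O statement
  have hO : (fun N ↦ ∑ n ∈ Finset.Icc 1 N, ‖a n‖ ^ 2) =O[atTop] fun N ↦ (N : ℝ) ^ (k : ℝ) := by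
    refine Asymptotics.IsBigO.of_bound K ?_
    filter_upwards [eventually_ge_atTop 1] with N hN
    rw [Real.norm_of_nonneg (Finset.sum_nonneg fun n _ ↦ sq_nonneg _),
      Real.norm_of_nonneg (Real.rpow_nonneg N.cast_nonneg _)]
    exact hK N hN
  have hk' : (0 : ℝ) ≤ k := by exact_mod_cast hk
  refine abscissaOfAbsConv_le_of_forall_lt_LSeriesSummable fun y hy ↦ ?_
  -- `ε > 0` with `y = (k+1)/2 + ε`
  set ε : ℝ := y - ((k : ℝ) + 1) / 2 with hε_def
  have hε : 0 < ε := by rw [hε_def]; linarith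
  -- `∑ ‖a n‖² n^{-(k+ε)}` converges
  have h1 : LSeriesSummable (fun n ↦ ((‖a n‖ ^ 2 : ℝ) : ℂ)) ((k : ℝ) + ε : ℝ) :=
    LSeriesSummable_of_sum_norm_bigO_and_nonneg hO (fun n ↦ sq_nonneg _) hk'
      (by simp only [ofReal_re]; linarith)
  -- `∑ n^{-(1+ε)}` converges
  have h2 : LSeriesSummable (fun _ ↦ (1 : ℂ)) ((1 : ℝ) + ε : ℝ) :=
    LSeriesSummable_of_bounded_of_one_lt_re (m := 1) (fun n _ ↦ by simp)
      (by simp only [ofReal_re]; linarith)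
  -- comparison
  refine Summable.of_norm_bounded (g := fun n ↦
    (‖term (fun n ↦ ((‖a n‖ ^ 2 : ℝ) : ℂ)) ((k : ℝ) + ε : ℝ) n‖ +
      ‖term (fun _ ↦ (1 : ℂ)) ((1 : ℝ) + ε : ℝ) n‖) / 2) ((h1.norm.add h2.norm).div_const 2) ?_
  intro n
  rcases eq_or_ne n 0 with rfl | hn
  · simp
  have hn0 : (0 : ℝ) < n := by exact_mod_cast Nat.pos_of_ne_zero hn
  simp only [norm_term_eq, if_neg hn, ofReal_re, norm_one, Complex.norm_real,
    Real.norm_of_nonneg (sq_nonneg _)]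
  -- `‖a n‖ / n^y = (‖a n‖ / n^{(k+ε)/2}) (1 / n^{(1+ε)/2})`
  have hy' : (y : ℝ) = ((k : ℝ) + ε) / 2 + (1 + ε) / 2 := by rw [hε_def]; ring
  have hsplit : ‖a n‖ / (n : ℝ) ^ (y : ℝ) =
      (‖a n‖ / (n : ℝ) ^ (((k : ℝ) + ε) / 2)) * (1 / (n : ℝ) ^ ((1 + ε) / 2)) := by
    rw [hy', Real.rpow_add hn0]
    field_simp
  have hA : (‖a n‖ / (n : ℝ) ^ (((k : ℝ) + ε) / 2)) ^ 2 = ‖a n‖ ^ 2 / (n : ℝ) ^ ((k : ℝ) + ε) := by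
    rw [div_pow, ← Real.rpow_natCast ((n : ℝ) ^ _), ← Real.rpow_mul hn0.le]
    norm_num
  have hB : (1 / (n : ℝ) ^ ((1 + ε) / 2)) ^ 2 = 1 / (n : ℝ) ^ (1 + ε) := by
    rw [div_pow, one_pow, ← Real.rpow_natCast ((n : ℝ) ^ _), ← Real.rpow_mul hn0.le]
    norm_num
  have := mul_le_half_add_sq (‖a n‖ / (n : ℝ) ^ (((k : ℝ) + ε) / 2)) (1 / (n : ℝ) ^ ((1 + ε) / 2))
  rw [← hsplit, hA, hB] at this
  convert this using 2


/-! ## The Mellin transform along the imaginary axis -/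


/-- On the imaginary axis the `q`-expansion reads `f(it) = ∑ a(n) e^{-2πnt}` (`t > 0`).
[folklore] -/
theorem hasSum_coeff_mul_exp (f : CuspForm 𝒮ℒ k) {t : ℝ} (ht : 0 < t) :
    HasSum (fun n : ℕ ↦ (qExpansion 1 f).coeff n * Real.exp (-(2 * π * n) * t))
      (f (ofComplex (Complex.I * t))) := by
  have him : 0 < (Complex.I * t).im := by simpa using ht
  set τ : ℍ := ⟨Complex.I * t, him⟩ with hτ
  have hof : ofComplex (Complex.I * t) = τ := ofComplex_apply_of_im_pos him
  have h := hasSum_qExpansion one_pos (SlashInvariantFormClass.periodic_comp_ofComplex f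
    one_mem_strictPeriods_SL) (ModularFormClass.holo f) (ModularFormClass.bdd_at_infty f) τ
  rw [hof]
  convert h using 2 with n
  rw [smul_eq_mul]
  congr 1
  rw [Function.Periodic.qParam, ← Complex.exp_nat_mul, Complex.ofReal_exp]
  congr 1
  rw [hτ]
  push_cast
  ring_nf
  rw [I_sq]
  ring

/-- **The Mellin transform of a level-one cusp form along the imaginary axis is `Γ(s)(2π)^{-s}`
times its `L`-series** wherever the latter converges absolutely and `Re s > 0`:
`Λ_f(s) = ∫_0^∞ f(iy) y^{s-1} dy = (2π)^{-s}Γ(s) ∑ a(n) n^{-s}` (termwise integration, Mathlib's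
`hasSum_mellin`). [cite: BookerThorne2014, Thm. 1 (definition of Λ_f)] -/
theorem cuspFormLambda_eq_Gamma_mul_LSeries (f : CuspForm 𝒮ℒ k) {s : ℂ} (hs : 0 < s.re)
    (habs : abscissaOfAbsConv (fun n ↦ (qExpansion 1 f).coeff n) < s.re) :
    cuspFormLambda f s =
      Gamma s * (2 * π : ℂ) ^ (-s) * LSeries (fun n ↦ (qExpansion 1 f).coeff n) s := by
  set a : ℕ → ℂ := fun n ↦ (qExpansion 1 f).coeff n with ha
  have ha0 : a 0 = 0 := CuspFormClass.qExpansion_coeff_zero f one_pos one_mem_strictPeriods_SL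
  have hsum : LSeriesSummable a s := LSeriesSummable_of_abscissaOfAbsConv_lt_re habs
  set p : ℕ → ℝ := fun n ↦ 2 * π * n with hp_def
  have hp : ∀ n, a n = 0 ∨ 0 < p n := by
    intro n
    rcases eq_or_ne n 0 with rfl | hn
    · exact Or.inl ha0
    · exact Or.inr (by simp only [hp_def]; positivity)
  have hF : ∀ t ∈ Ioi (0 : ℝ), HasSum (fun n ↦ a n * Real.exp (-p n * t))
      (f (ofComplex (Complex.I * t))) := fun t ht ↦ hasSum_coeff_mul_exp f ht
  have h2π : (0 : ℝ) < 2 * π := by positivity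
  -- summability of `‖a n‖ / (2πn)^{Re s}`
  have h_sum : Summable fun n ↦ ‖a n‖ / (p n) ^ s.re := by
    have h1 : Summable fun n ↦ (2 * π) ^ (-s.re) * ‖term a s n‖ := hsum.norm.mul_left _
    refine h1.congr fun n ↦ ?_
    rcases eq_or_ne n 0 with rfl | hn
    · simp [ha0]
    · rw [norm_term_eq, if_neg hn, hp_def]
      simp only
      rw [Real.mul_rpow h2π.le n.cast_nonneg, Real.rpow_neg h2π.le]
      field_simp
  have hmellin := hasSum_mellin hp hs hF h_sum
  -- the same series, written with `term a s`
  have hL : HasSum (fun n ↦ Gamma s * (2 * π : ℂ) ^ (-s) * term a s n)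
      (Gamma s * (2 * π : ℂ) ^ (-s) * LSeries a s) := (hsum.LSeriesHasSum).mul_left _
  have heq : (fun n ↦ Gamma s * a n / (p n : ℂ) ^ s) =
      fun n ↦ Gamma s * (2 * π : ℂ) ^ (-s) * term a s n := by
    funext n
    rcases eq_or_ne n 0 with rfl | hn
    · simp [ha0]
    · rw [term_of_ne_zero hn, hp_def]
      simp only
      push_cast
      have h2πc : ((2 * π : ℝ) : ℂ) ^ s ≠ 0 := by
        rw [Ne, cpow_eq_zero_iff, not_and_or]
        exact Or.inl (by exact_mod_cast h2π.ne')
      have hnc : (n : ℂ) ^ s ≠ 0 := by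
        rw [Ne, cpow_eq_zero_iff, not_and_or]
        exact Or.inl (by exact_mod_cast hn)
      rw [show (2 * (π : ℂ) * (n : ℂ)) = ((2 * π : ℝ) : ℂ) * ((n : ℝ) : ℂ) by push_cast; ring,
        mul_cpow_ofReal_nonneg h2π.le n.cast_nonneg, cpow_neg]
      push_cast at h2πc ⊢
      field_simp
  rw [heq] at hmellin
  rw [cuspFormLambda]
  exact hmellin.unique hL

/-- Hence a zero of `Λ_f` with `Re s > 0` in the half-plane of absolute convergence is a zero of
the `L`-series. [folklore] -/
theorem LSeries_eq_zero_of_cuspFormLambda_eq_zero (f : CuspForm 𝒮ℒ k) {s : ℂ} (hs : 0 < s.re)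
    (habs : abscissaOfAbsConv (fun n ↦ (qExpansion 1 f).coeff n) < s.re)
    (h0 : cuspFormLambda f s = 0) : LSeries (fun n ↦ (qExpansion 1 f).coeff n) s = 0 := by
  rw [cuspFormLambda_eq_Gamma_mul_LSeries f hs habs] at h0
  have hG : Gamma s ≠ 0 := Gamma_ne_zero_of_re_pos hs
  have h2π : (2 * π : ℂ) ^ (-s) ≠ 0 := by
    rw [Ne, cpow_eq_zero_iff, not_and_or]
    exact Or.inl (by exact_mod_cast (by positivity : (2 * π : ℝ) ≠ 0))
  simpa [hG, h2π] using h0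


/-! ## One zero gives infinitely many (Bohr translates and Hurwitz) -/

/-- A strictly increasing sequence with gaps eventually `≥ δ > 0` is unbounded. [folklore] -/
theorem exists_le_of_eventually_gap {τ : ℕ → ℝ} {δ : ℝ} (hδ : 0 < δ)
    (hgap : ∀ᶠ m in atTop, δ ≤ τ (m + 1) - τ m) (K : ℝ) : ∃ m, K ≤ τ m := by
  obtain ⟨m₀, hm₀⟩ := eventually_atTop.1 hgap
  have hind : ∀ n : ℕ, τ m₀ + n * δ ≤ τ (m₀ + n) := by
    intro n
    induction n with
    | zero => simp
    | succ n ih =>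
      have h := hm₀ (m₀ + n) (Nat.le_add_right _ _)
      rw [show m₀ + (n + 1) = m₀ + n + 1 by ring]
      push_cast
      linarith
  obtain ⟨n, hn⟩ := exists_nat_ge ((K - τ m₀) / δ)
  refine ⟨m₀ + n, ?_⟩
  have h1 : K - τ m₀ ≤ n * δ := by
    rw [div_le_iff₀ hδ] at hn
    linarith
  linarith [hind n]

/-- **Bohr's vertical shifts with a prescribed accuracy and a large shift.** For an `L`-series
absolutely convergent on `Re s > σ` and `σ < α < β`, `ε > 0`, `K`, there is a real `t ≥ K` with
`‖L(s) − L(s + it)‖ < ε` on the strip `α ≤ Re s ≤ β` (from `bohr_almost_periodic_holds`).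
[cite: BohrMA1922, Satz 1] -/
theorem exists_shift_ge_forall_norm_sub_lt (b : ℕ → ℂ) {α β ε : ℝ}
    (hα : abscissaOfAbsConv b < α) (hαβ : α < β) (hε : 0 < ε) (K : ℝ) :
    ∃ t : ℝ, K ≤ t ∧ ∀ s : ℂ, α ≤ s.re → s.re ≤ β →
      ‖LSeries b s - LSeries b (s + t * I)‖ < ε := by
  obtain ⟨τ, -, -, ⟨δ, hδ, hgap⟩, -, hτ⟩ :=
    Literature.NumberTheory.LFunctions.bohr_almost_periodic_holds b α β ε hα hαβ hε
  obtain ⟨m, hm⟩ := exists_le_of_eventually_gap hδ hgap K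
  exact ⟨τ m, hm, fun s h1 h2 ↦ hτ m s h1 h2⟩

/-- **One zero in the half-plane of absolute convergence gives infinitely many** (the
Davenport–Heilbronn / Bohr mechanism: vertical translates `L(s + it)` approximate `L(s)`
uniformly near the zero, and Hurwitz's theorem — here via the maximum modulus principle — puts a
zero of each good translate next to it). If `L(s) = ∑ b(n) n^{-s}` converges absolutely at
`Re s = Re s₀` (i.e. `abscissaOfAbsConv b < Re s₀`) and `L(s₀) = 0`, then for every `σ₁ < Re s₀`
there are infinitely many `s` with `Re s > σ₁` at which the series converges absolutely and
vanishes. [cite: ConreyGhosh1994, §8, p. 415 ("it then follows from Rouché's Theorem that G(s) has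
infinitely many zeros in σ > 1")] -/
theorem LSeries_setOf_zero_infinite {b : ℕ → ℂ} {s₀ : ℂ} {σ₁ : ℝ}
    (habs : abscissaOfAbsConv b < s₀.re) (hσ₁ : σ₁ < s₀.re) (h0 : LSeries b s₀ = 0) :
    {s : ℂ | σ₁ < s.re ∧ LSeriesSummable b s ∧ LSeries b s = 0}.Infinite := by
  set S : Set ℂ := {s : ℂ | σ₁ < s.re ∧ LSeriesSummable b s ∧ LSeries b s = 0} with hS
  -- a real `α` with `max (abscissa, σ₁) < α < Re s₀`
  obtain ⟨α, hα, hαs₀⟩ : ∃ α : ℝ, abscissaOfAbsConv b < α ∧ σ₁ < α ∧ α < s₀.re := by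
    obtain ⟨a, ha1, ha2⟩ := EReal.lt_iff_exists_real_btwn.1 habs
    refine ⟨max a ((σ₁ + s₀.re) / 2), lt_of_lt_of_le ha1 (by exact_mod_cast le_max_left _ _),
      lt_of_lt_of_le (by linarith) (le_max_right _ _), max_lt (by exact_mod_cast ha2) (by linarith)⟩
  obtain ⟨hσ₁α, hαs₀⟩ := hαs₀
  have hU : IsOpen {s : ℂ | (α : ℝ) < s.re} := isOpen_lt continuous_const continuous_re
  have hs₀U : s₀ ∈ {s : ℂ | (α : ℝ) < s.re} := hαs₀
  -- points with `Re > α` are points of absolute convergence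
  have hsum : ∀ s : ℂ, α < s.re → LSeriesSummable b s := fun s hs ↦
    LSeriesSummable_of_abscissaOfAbsConv_lt_re (lt_trans hα (by exact_mod_cast hs))
  have habs' : ∀ s : ℂ, α < s.re → abscissaOfAbsConv b < s.re := fun s hs ↦
    lt_trans hα (by exact_mod_cast hs)
  have han : AnalyticOnNhd ℂ (LSeries b) {s : ℂ | (α : ℝ) < s.re} :=
    fun s hs ↦ LSeries_analyticOnNhd b s (habs' s hs)
  rcases (han s₀ hs₀U).eventually_eq_zero_or_eventually_ne_zero with hz | hnz
  · -- `L` vanishes near `s₀`: a whole neighbourhood of zeros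
    have hT : {z : ℂ | LSeries b z = 0 ∧ α < z.re} ∈ 𝓝 s₀ := hz.and (hU.mem_nhds hs₀U)
    refine (infinite_of_mem_nhds s₀ hT).mono ?_
    rintro z ⟨hz0, hzα⟩
    exact ⟨lt_trans hσ₁α hzα, hsum z hzα, hz0⟩
  -- `s₀` is an isolated zero: a closed disc in `Re > α` with `L ≠ 0` on its boundary circle
  have h' : ∀ᶠ z in 𝓝 s₀, (z ≠ s₀ → LSeries b z ≠ 0) ∧ α < z.re :=
    (eventually_nhdsWithin_iff.1 hnz).and (hU.mem_nhds hs₀U)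
  obtain ⟨r₀, hr₀, hball⟩ := Metric.eventually_nhds_iff_ball.1 h'
  set r : ℝ := r₀ / 2 with hr_def
  have hr : 0 < r := by positivity
  have hsub : closedBall s₀ r ⊆ ball s₀ r₀ := closedBall_subset_ball (by rw [hr_def]; linarith)
  have hre_of_mem : ∀ z ∈ closedBall s₀ r, s₀.re - r ≤ z.re ∧ z.re ≤ s₀.re + r := by
    intro z hz
    have h1 : |(z - s₀).re| ≤ ‖z - s₀‖ := abs_re_le_norm _
    rw [mem_closedBall, dist_eq_norm] at hz
    rw [sub_re] at h1
    constructor <;> linarith [(abs_le.1 (h1.trans hz)).1, (abs_le.1 (h1.trans hz)).2]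
  have hαball : ∀ z ∈ closedBall s₀ r, α < z.re := fun z hz ↦ (hball z (hsub hz)).2
  have hsphere : ∀ z ∈ sphere s₀ r, LSeries b z ≠ 0 := by
    intro z hz
    have hz' : z ∈ ball s₀ r₀ := hsub (sphere_subset_closedBall hz)
    refine (hball z hz').1 ?_
    intro hzs
    rw [hzs, mem_sphere, dist_self] at hz
    exact hr.ne hz
  -- the shifts `t k ≥ k` with accuracy `1/(k+1)` on the strip `s₀.re - r ≤ Re s ≤ s₀.re + r`
  have hstrip : abscissaOfAbsConv b < (s₀.re - r : ℝ) := by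
    have := hαball (s₀ - r) (by simp [mem_closedBall, abs_of_pos hr])
    simp only [sub_re, ofReal_re] at this
    exact lt_trans hα (by exact_mod_cast this)
  have hlt : s₀.re - r < s₀.re + r := by linarith
  choose t htk ht using fun k : ℕ ↦
    exists_shift_ge_forall_norm_sub_lt b hstrip hlt (ε := 1 / ((k : ℝ) + 1)) (by positivity) k
  set F : ℕ → ℂ → ℂ := fun k s ↦ LSeries b (s + t k * I) with hF
  have hunif : TendstoUniformlyOn F (LSeries b) atTop (closedBall s₀ r) := by
    rw [Metric.tendstoUniformlyOn_iff]
    intro ε hε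
    obtain ⟨k₀, hk₀⟩ := exists_nat_one_div_lt hε
    filter_upwards [eventually_ge_atTop k₀] with k hk s hs
    rw [dist_eq_norm]
    obtain ⟨h1, h2⟩ := hre_of_mem s hs
    refine (ht k s h1 h2).trans_le ((le_of_lt ?_))
    refine lt_of_le_of_lt ?_ hk₀
    have hk' : (k₀ : ℝ) ≤ k := by exact_mod_cast hk
    gcongr
  have hFdiff : ∀ᶠ k in atTop, DiffContOnCl ℂ (F k) (ball s₀ r) := by
    refine Eventually.of_forall fun k ↦ ?_
    have hdiff : DifferentiableOn ℂ (F k) {s : ℂ | (α : ℝ) < s.re} := by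
      intro z hz
      have hz' : abscissaOfAbsConv b < (z + t k * I).re := by
        have : (z + t k * I).re = z.re := by simp
        rw [this]
        exact habs' z hz
      have h1 : DifferentiableAt ℂ (LSeries b) (z + t k * I) :=
        (LSeries_hasDerivAt hz').differentiableAt
      exact (h1.comp z ((differentiableAt_id).add_const _)).differentiableWithinAt
    exact hdiff.diffContOnCl_ball (fun z hz ↦ hαball z hz)
  have hcont : ContinuousOn (LSeries b) (sphere s₀ r) :=
    han.continuousOn.mono fun z hz ↦ hαball z (sphere_subset_closedBall hz)
  have hev := Complex.eventually_exists_zero_mem_ball_of_tendstoUniformlyOn hr hFdiff hunif hcont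
    h0 hsphere
  -- infinitely many zeros: their imaginary parts are unbounded
  by_contra hfin
  rw [Set.not_infinite] at hfin
  obtain ⟨B, hB⟩ := (hfin.image fun s : ℂ ↦ |s.im|).bddAbove
  obtain ⟨k, ⟨z, hz, hz0⟩, hk⟩ := (hev.and (eventually_ge_atTop ⌈B + |s₀.im| + r⌉₊)).exists
  have hzr : ‖z - s₀‖ < r := by rwa [mem_ball, dist_eq_norm] at hz
  have hzα : α < z.re := hαball z (ball_subset_closedBall hz)
  have hre : σ₁ < (z + t k * I).re := by
    have : (z + t k * I).re = z.re := by simp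
    rw [this]
    exact lt_trans hσ₁α hzα
  have hmem : z + t k * I ∈ S := ⟨hre, hsum _ (by simpa using hzα), hz0⟩
  have hbound := hB (mem_image_of_mem (fun s : ℂ ↦ |s.im|) hmem)
  have him : |z.im - s₀.im| < r := by
    have h1 : |(z - s₀).im| ≤ ‖z - s₀‖ := abs_im_le_norm _
    rw [sub_im] at h1
    exact h1.trans_lt hzr
  have hk' : B + |s₀.im| + r ≤ k := (Nat.le_ceil _).trans (by exact_mod_cast hk)
  have himw : (z + t k * I).im = z.im + t k := by simp
  simp only [himw] at hbound
  have htk' := htk k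
  have h3 : z.im + t k ≤ |z.im + t k| := le_abs_self _
  have h4 : -|z.im - s₀.im| ≤ z.im - s₀.im := neg_abs_le _
  have h5 : -|s₀.im| ≤ s₀.im := neg_abs_le _
  linarith


/-! ## Assembly for `Δ²` -/

/-- `Δ²` is (the underlying function of) a level-one cusp form of weight `24` (`Δ · Δ`, Mathlib's
`CuspForm.mulModularForm`). [cite: ConreyGhosh1994, §8, p. 415 ("Δ(z)² is a cusp form of weight
24 for the full modular group")] -/
theorem exists_cuspForm_coe_eq_discriminant_sq :
    ∃ g : CuspForm 𝒮ℒ 24, (g : ℍ → ℂ) = fun z : ℍ ↦ ModularForm.discriminant z ^ 2 := by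
  refine ⟨CuspForm.mcast (by norm_num) (CuspForm.discriminant.mulModularForm
    (CuspForm.discriminant : ModularForm 𝒮ℒ 12)), ?_⟩
  funext z
  rw [sq]
  rfl

/-- For such a `g`, the `q`-expansion coefficients are `deltaSqCoeff`. [folklore] -/
theorem qExpansion_coeff_eq_deltaSqCoeff {g : CuspForm 𝒮ℒ 24}
    (hg : (g : ℍ → ℂ) = fun z : ℍ ↦ ModularForm.discriminant z ^ 2) :
    (fun n ↦ (qExpansion 1 g).coeff n) = deltaSqCoeff := by
  funext n
  rw [deltaSqCoeff, hg]

/-- **`σ_a(Δ²) ≤ 25/2`**: the Dirichlet series `∑ f(n) n^{-s}` of `Δ²` converges absolutely for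
`Re s > 25/2` (in print from Deligne's bound; here from the Rankin–Hecke mean square).
[cite: ConreyGhosh1994, §8, p. 415] -/
theorem abscissaOfAbsConv_deltaSqCoeff_le :
    abscissaOfAbsConv deltaSqCoeff ≤ ((25 / 2 : ℝ) : EReal) := by
  obtain ⟨g, hg⟩ := exists_cuspForm_coe_eq_discriminant_sq
  have h := abscissaOfAbsConv_coeff_le g (by norm_num)
  rw [qExpansion_coeff_eq_deltaSqCoeff hg] at h
  refine h.trans (le_of_eq ?_)
  norm_num

/-- **Reduction to one zero.** If `L(s, Δ²)` has one zero with `Re s > 25/2`, then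
`ConreyGhosh1994_thm2` holds (Bohr translates + Hurwitz, `LSeries_setOf_zero_infinite`).
[cite: ConreyGhosh1994, §8, p. 415] -/
theorem ConreyGhosh1994_thm2_of_exists_zero
    (h : ∃ s₀ : ℂ, (25 / 2 : ℝ) < s₀.re ∧ LSeries deltaSqCoeff s₀ = 0) : ConreyGhosh1994_thm2 := by
  obtain ⟨s₀, hs₀, h0⟩ := h
  have habs : abscissaOfAbsConv deltaSqCoeff < s₀.re :=
    lt_of_le_of_lt abscissaOfAbsConv_deltaSqCoeff_le (by exact_mod_cast hs₀)
  exact LSeries_setOf_zero_infinite habs hs₀ h0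

/-- A zero of `Λ_{Δ²}` with `Re s > 25/2` is a zero of `L(s, Δ²)`. [folklore] -/
theorem LSeries_deltaSqCoeff_eq_zero_of_cuspFormLambda {g : CuspForm 𝒮ℒ 24}
    (hg : (g : ℍ → ℂ) = fun z : ℍ ↦ ModularForm.discriminant z ^ 2) {s : ℂ}
    (hs : (25 / 2 : ℝ) < s.re) (hΛ : cuspFormLambda g s = 0) : LSeries deltaSqCoeff s = 0 := by
  have habs : abscissaOfAbsConv (fun n ↦ (qExpansion 1 g).coeff n) < s.re := by
    rw [qExpansion_coeff_eq_deltaSqCoeff hg]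
    exact lt_of_le_of_lt abscissaOfAbsConv_deltaSqCoeff_le (by exact_mod_cast hs)
  have h := LSeries_eq_zero_of_cuspFormLambda_eq_zero g (by linarith) habs hΛ
  rwa [qExpansion_coeff_eq_deltaSqCoeff hg] at h

/-- **Conrey–Ghosh's Theorem 2 from Booker–Thorne's Theorem 1 (level one).** `Δ²` is a level-one
cusp form of weight `24` which is not an eigenfunction of `T₂` (`f(1) = 0`, `f(2) = 1`), so under
`BookerThorne2014_thm1_levelOne` its completed `L`-function has a zero with `Re s > 25/2`; by
`Λ = Γ(s)(2π)^{-s}L` this is a zero of `L(s, Δ²)` in the half-plane of absolute convergence, and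
`ConreyGhosh1994_thm2_of_exists_zero` applies. [cite: ConreyGhosh1994, Thm. 2]
[cite: BookerThorne2014, Thm. 1] -/
theorem ConreyGhosh1994_thm2_of_BookerThorne2014 (h : BookerThorne2014_thm1_levelOne) :
    ConreyGhosh1994_thm2 := by
  obtain ⟨g, hg⟩ := exists_cuspForm_coe_eq_discriminant_sq
  have hne : ¬ IsLevelOneHeckeEigenAt 24 (fun n ↦ (qExpansion 1 g).coeff n) 2 := by
    rw [qExpansion_coeff_eq_deltaSqCoeff hg]
    exact not_isLevelOneHeckeEigenAt_deltaSq
  obtain ⟨s, hs, hΛ⟩ := h.exists_zero g Nat.prime_two hne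
  have hs' : (25 / 2 : ℝ) < s.re := by
    refine lt_of_eq_of_lt ?_ hs
    norm_num
  exact ConreyGhosh1994_thm2_of_exists_zero
    ⟨s, hs', LSeries_deltaSqCoeff_eq_zero_of_cuspFormLambda hg hs' hΛ⟩

/-- The same from the quantitative form `BookerThorne2014_levelOne_zeros` (which in particular
gives one zero of `Λ_{Δ²}` with `Re s > 25/2`). [cite: BookerThorne2014, Thm. 1 and §1, Remark 2] -/
theorem ConreyGhosh1994_thm2_of_BookerThorne2014_zeros (h : BookerThorne2014_levelOne_zeros) :
    ConreyGhosh1994_thm2 := by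
  obtain ⟨g, hg⟩ := exists_cuspForm_coe_eq_discriminant_sq
  have hne : ¬ IsLevelOneHeckeEigenAt 24 (fun n ↦ (qExpansion 1 g).coeff n) 2 := by
    rw [qExpansion_coeff_eq_deltaSqCoeff hg]
    exact not_isLevelOneHeckeEigenAt_deltaSq
  obtain ⟨s, hs, hΛ⟩ := (h.infinite g Nat.prime_two hne).nonempty
  have hs' : (25 / 2 : ℝ) < s.re := by
    refine lt_of_eq_of_lt ?_ hs
    norm_num
  exact ConreyGhosh1994_thm2_of_exists_zero
    ⟨s, hs', LSeries_deltaSqCoeff_eq_zero_of_cuspFormLambda hg hs' hΛ⟩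

end Literature.Barriers.RiemannHypothesis

end
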